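import Summits.MatrixMultiplication.OmegaCensus.STPPKernelListerLeaf
import Summits.MatrixMultiplication.OmegaCensus.STPPKneserFilter
import Summits.MatrixMultiplication.OmegaCensus.STPPClosureFilter
import Summits.MatrixMultiplication.OmegaCensus.STPPAlignedDoubleKneserFilter

/-!
# ω-census (abelian STPP census): kernel lister — leaf soundness, part 2: the Kneser-type list filters are the tree's filters (kernel)

HONEST FRAMING (pub-omega census; verbatim): lottery ticket; floor = certified bounds/negative ranges.
Census STRUCTURE (seat pub-omega-stpp-2 gen 29, 2026-08-29), family (b2).  Nothing here is progress on `ω`.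

The lister's list-native leaf filters `n8DeadL`, `n18DeadL`, `n12DeadL` (`STPPKernelListerDefs.lean`) are bridged to the tree's card-vector predicates
`STPPKneser.N8Dead1`, `CubeNB.N18Dead1`, `CubeNB.N12Dead1` on the realising family (each role reading via the realisability of the corresponding role
image, `Realizable.rot/rev`), so a realisable pattern passes all of them (`not_n8DeadL`, `not_n18DeadL`, `not_n12DeadL`), and `treeDeadL` excludes realisable
patterns (`not_treeDeadL`).  With part 1 this gives the `leaf` fact of `SearchHypH`.
-/

open Finset

namespace Summit.MatrixMultiplication.OmegaCensus.KLister

open Literature.Computability.AlgebraicComplexity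

variable {H : Type*} [AddCommGroup H] [Fintype H] {n : ℕ}

/-! ## Translation lemmas -/

/-- `Q.getD j 0 = Q.get ⟨j, _⟩`. [folklore] -/
theorem getD_eq_get' (Q : List Shape) (j : ℕ) (hj : j < Q.length) : Q.getD j (0, 0, 0) = Q.get ⟨j, hj⟩ := by
  rw [List.get_eq_getElem, List.getD_eq_getElem _ _ hj]

/-- Membership in `divList n`. [folklore] -/
theorem mem_divList {n d : ℕ} : d ∈ divList n ↔ d < n + 1 ∧ 0 < d ∧ d ∣ n := by
  simp [divList]

/-- `divList n` quantification vs the bounded divisor quantifier of the tree predicates. [folklore] -/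
theorem divList_all_iff {n : ℕ} {φ : ℕ → Bool} : ((divList n).all φ) = true ↔ ∀ d : ℕ, d < n + 1 → d ∣ n → 0 < d → φ d = true := by
  rw [List.all_eq_true]
  constructor
  · intro h d h1 h2 h3; exact h d (mem_divList.2 ⟨h1, h3, h2⟩)
  · intro h d hd; obtain ⟨h1, h3, h2⟩ := mem_divList.1 hd; exact h d h1 h2 h3

/-- `divList n` quantification vs `Nat.divisors n` (for `n ≠ 0`). [folklore] -/
theorem divList_all_iff' {n : ℕ} (hn : n ≠ 0) {φ : ℕ → Bool} : ((divList n).all φ) = true ↔ ∀ d ∈ Nat.divisors n, φ d = true := by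
  rw [List.all_eq_true]
  constructor
  · intro h d hd
    rw [Nat.mem_divisors] at hd
    exact h d (mem_divList.2 ⟨Nat.lt_succ_of_le (Nat.le_of_dvd (Nat.pos_of_ne_zero hn) hd.1), Nat.pos_of_dvd_of_pos hd.1 (Nat.pos_of_ne_zero hn), hd.1⟩)
  · intro h d hd
    obtain ⟨-, -, h2⟩ := mem_divList.1 hd
    exact h d (Nat.mem_divisors.2 ⟨h2, hn⟩)

/-- The lister's `kLB` is the tree's `kneserLB`. [folklore] -/
theorem kLB_eq (s t d : ℕ) : kLB s t d = STPPKneser.kneserLB s t d := rfl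

/-! ## N8 -/

/-- **Bridge for one N8 reading.** [folklore] -/
theorem N8Dead1_of_n8Dead1L {Q : List Shape} (h : n8Dead1L n (divList n) Q = true) :
    STPPKneser.N8Dead1 n Q.length (fun i => (Q.get i).1) (fun i => (Q.get i).2.1) (fun i => (Q.get i).2.2) = true := by
  unfold STPPKneser.N8Dead1
  rw [decide_eq_true_eq]
  simp only [n8Dead1L, List.any_eq_true, List.mem_range, Bool.and_eq_true, Bool.not_eq_true', Bool.or_eq_true] at h
  obtain ⟨j, hj, k, hk, hjk, h⟩ := h
  have hjk' : j ≠ k := Nat.ne_of_beq_eq_false hjk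
  refine ⟨⟨j, hj⟩, ⟨k, hk⟩, fun e => hjk' (by simpa [Fin.ext_iff] using e), ?_⟩
  rw [getD_eq_get' Q j hj, getD_eq_get' Q k hk] at h
  have hX : ∑ i : Fin Q.length, (Q.get i).1 * (Q.get i).2.1 = (Q.map pab).sum := sum_get Q pab
  have hY : ∑ i : Fin Q.length, (Q.get i).2.1 * (Q.get i).2.2 = (Q.map pbc).sum := sum_get Q pbc
  have hZ : ∑ i : Fin Q.length, (Q.get i).1 * (Q.get i).2.2 = (Q.map pca).sum := sum_get Q pca
  have hYj : ∑ i ∈ univ.erase (⟨j, hj⟩ : Fin Q.length), (Q.get i).2.1 * (Q.get i).2.2 = (Q.map pbc).sum - pbc (Q.get ⟨j, hj⟩) := by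
    have := sum_erase_get Q pbc ⟨j, hj⟩; simp only [pbc] at this ⊢; omega
  have hXj : ∑ i ∈ univ.erase (⟨j, hj⟩ : Fin Q.length), (Q.get i).1 * (Q.get i).2.1 = (Q.map pab).sum - pab (Q.get ⟨j, hj⟩) := by
    have := sum_erase_get Q pab ⟨j, hj⟩; simp only [pab] at this ⊢; omega
  rw [hX, hY, hZ, hYj, hXj]
  rcases h with (h | h) | h
  · left; intro d h1 h2 h3
    have := (divList_all_iff.1 h) d h1 h2 h3
    rw [Nat.blt_eq] at this; exact this
  · right; left; intro d h1 h2 h3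
    have := (divList_all_iff.1 h) d h1 h2 h3
    rw [Nat.blt_eq] at this; exact this
  · right; right; intro d h1 h2 h3
    have := (divList_all_iff.1 h) d h1 h2 h3
    rw [Nat.blt_eq] at this; exact this

/-- One N8 reading kills a realisable pattern. [folklore] -/
theorem false_of_n8Dead1L [DecidableEq H] (hn : Fintype.card H = n) {Q : List Shape} (hQ : Realizable H Q) (h : n8Dead1L n (divList n) Q = true) :
    False := by
  obtain ⟨A, B, C, hS, hc⟩ := hQ.out
  exact STPPKneser.not_isSTPP_of_n8Dead1 hS (fun i => (hc i).1) (fun i => (hc i).2.1) (fun i => (hc i).2.2.1) hn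
    (fun i => (hc i).2.2.2.1) (fun i => (hc i).2.2.2.2.1) (fun i => (hc i).2.2.2.2.2) (N8Dead1_of_n8Dead1L h)

/-- **`n8DeadL` is sound.** [folklore] -/
theorem not_n8DeadL [DecidableEq H] (hn : Fintype.card H = n) {P : List Shape} (hP : Realizable H P) : n8DeadL n P = false := by
  rw [Bool.eq_false_iff]
  intro h
  simp only [n8DeadL, Bool.or_eq_true] at h
  rcases h with (h | h) | h
  · exact false_of_n8Dead1L hn hP h
  · exact false_of_n8Dead1L hn hP.rot h
  · exact false_of_n8Dead1L hn hP.rot.rot h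

/-! ## N18 -/

/-- **Bridge for one N18 reading** (`n ≠ 0`). [folklore] -/
theorem N18Dead1_of_n18Dead1L (hn0 : n ≠ 0) {Q : List Shape} (h : n18Dead1L n (divList n) Q = true) :
    CubeNB.N18Dead1 n Q.length (fun i => (Q.get i).1) (fun i => (Q.get i).2.1) (fun i => (Q.get i).2.2) = true := by
  unfold CubeNB.N18Dead1
  rw [decide_eq_true_eq]
  simp only [n18Dead1L, Bool.and_eq_true, Nat.blt_eq, List.any_eq_true] at h
  obtain ⟨hlen, t, ht, h⟩ := h
  obtain ⟨i, rfl⟩ := exists_get_of_mem ht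
  -- another index exists since the length is `≥ 2`
  have hj : ∃ j : Fin Q.length, j ≠ i := by
    by_cases hi : (i : ℕ) = 0
    · exact ⟨⟨1, by omega⟩, fun e => by simp [Fin.ext_iff, hi] at e⟩
    · exact ⟨⟨0, by omega⟩, fun e => hi (by simpa [Fin.ext_iff] using e.symm)⟩
  obtain ⟨j, hji⟩ := hj
  refine ⟨i, j, hji, fun d hd d' hd' => ?_⟩
  have hZ : ∑ k ∈ univ.erase i, (Q.get k).1 * (Q.get k).2.2 = (Q.map pca).sum - pca (Q.get i) := by
    have := sum_erase_get Q pca i; simp only [pca] at this ⊢; omega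
  have hY : ∑ k ∈ univ.erase i, (Q.get k).2.1 * (Q.get k).2.2 = (Q.map pbc).sum - pbc (Q.get i) := by
    have := sum_erase_get Q pbc i; simp only [pbc] at this ⊢; omega
  rw [hZ, hY]
  have h1 := (divList_all_iff' hn0).1 h d hd
  have h2 := (divList_all_iff' hn0).1 h1 d' hd'
  rw [Nat.blt_eq] at h2
  simpa [svol, kLB_eq] using h2

/-- One N18 reading kills a realisable pattern. [folklore] -/
theorem false_of_n18Dead1L [DecidableEq H] (hn : Fintype.card H = n) (hn0 : n ≠ 0) {Q : List Shape} (hQ : Realizable H Q)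
    (h : n18Dead1L n (divList n) Q = true) : False := by
  obtain ⟨A, B, C, hS, hc⟩ := hQ.out
  exact CubeNB.not_isSTPP_of_n18Dead1 hS (fun i => (hc i).1) (fun i => (hc i).2.1) (fun i => (hc i).2.2.1) hn
    (fun i => (hc i).2.2.2.1) (fun i => (hc i).2.2.2.2.1) (fun i => (hc i).2.2.2.2.2) (N18Dead1_of_n18Dead1L hn0 h)

/-- **`n18DeadL` is sound** (six readings). [folklore] -/
theorem not_n18DeadL [DecidableEq H] (hn : Fintype.card H = n) (hn0 : n ≠ 0) {P : List Shape} (hP : Realizable H P) : n18DeadL n P = false := by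
  rw [Bool.eq_false_iff]
  intro h
  simp only [n18DeadL, Bool.or_eq_true] at h
  rcases h with ((((h | h) | h) | h) | h) | h
  · exact false_of_n18Dead1L hn hn0 hP h
  · exact false_of_n18Dead1L hn hn0 hP.rot h
  · exact false_of_n18Dead1L hn hn0 hP.rot.rot h
  · exact false_of_n18Dead1L hn hn0 hP.rev h
  · exact false_of_n18Dead1L hn hn0 hP.rot.rot.rev h
  · exact false_of_n18Dead1L hn hn0 hP.rot.rev h


/-! ## N12 -/

/-- Members are below `foldl max`. [folklore] -/
theorem le_foldl_max : ∀ (l : List ℕ) (a x : ℕ), (x = a ∨ x ∈ l) → x ≤ l.foldl max a := by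
  intro l
  induction l with
  | nil =>
    intro a x h
    rcases h with rfl | h
    · simp
    · simp at h
  | cons y l ih =>
    intro a x h
    rw [List.foldl_cons]
    rcases h with rfl | h
    · exact (le_max_left _ _).trans (ih _ _ (Or.inl rfl))
    · rcases List.mem_cons.1 h with rfl | h
      · exact (le_max_right _ _).trans (ih _ _ (Or.inl rfl))
      · exact ih _ _ (Or.inr h)

/-- `foldl max` is below any common bound. [folklore] -/
theorem foldl_max_le : ∀ (l : List ℕ) (a b : ℕ), a ≤ b → (∀ x ∈ l, x ≤ b) → l.foldl max a ≤ b := by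
  intro l
  induction l with
  | nil => intro a b ha _; simpa using ha
  | cons y l ih =>
    intro a b ha h
    rw [List.foldl_cons]
    exact ih _ _ (max_le ha (h y List.mem_cons_self)) (fun x hx => h x (List.mem_cons_of_mem _ hx))

/-- `Finset.univ.sup` over positions is the list maximum. [folklore] -/
theorem sup_get_eq_foldl_max (Q : List Shape) (f : Shape → ℕ) :
    (univ : Finset (Fin Q.length)).sup (fun i => f (Q.get i)) = (Q.map f).foldl max 0 := by
  apply le_antisymm
  · exact Finset.sup_le fun i _ => le_foldl_max _ _ _ (Or.inr (List.mem_map_of_mem (List.get_mem _ _)))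
  · refine foldl_max_le _ _ _ (Nat.zero_le _) (fun x hx => ?_)
    obtain ⟨t, ht, rfl⟩ := List.mem_map.1 hx
    obtain ⟨i, rfl⟩ := exists_get_of_mem ht
    exact Finset.le_sup (f := fun i => f (Q.get i)) (Finset.mem_univ i)

/-- **Bridge for one N12 rotation.** [folklore] -/
theorem N12Dead1_of_n12Dead1L {Q : List Shape} (h : n12Dead1L n Q = true) :
    CubeNB.N12Dead1 n Q.length (fun i => (Q.get i).1) (fun i => (Q.get i).2.1) (fun i => (Q.get i).2.2) = true := by
  unfold CubeNB.N12Dead1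
  have h1 : ∑ i : Fin Q.length, (Q.get i).1 * (Q.get i).2.1 = (Q.map pab).sum := sum_get Q pab
  have h2 : ∑ i : Fin Q.length, (Q.get i).2.1 * (Q.get i).2.2 = (Q.map pbc).sum := sum_get Q pbc
  have h3 : ∑ i : Fin Q.length, (Q.get i).1 * (Q.get i).2.2 = (Q.map pca).sum := sum_get Q pca
  have hv : ∑ i : Fin Q.length, (Q.get i).1 * (Q.get i).2.1 * (Q.get i).2.2 = (Q.map svol).sum := sum_get Q svol
  have h5 := sup_get_eq_foldl_max Q (fun s => s.1)
  have h6 := sup_get_eq_foldl_max Q (fun s => s.2.2)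
  simp only [h1, h2, h3, hv, h5, h6]
  exact h

/-- One N12 rotation kills a realisable pattern. [folklore] -/
theorem false_of_n12Dead1L [DecidableEq H] (hn : Fintype.card H = n) {Q : List Shape} (hQ : Realizable H Q) (h : n12Dead1L n Q = true) : False := by
  obtain ⟨A, B, C, hS, hc⟩ := hQ.out
  exact CubeNB.not_isSTPP_of_n12Dead1 hS (fun i => (hc i).1) (fun i => (hc i).2.1) (fun i => (hc i).2.2.1) hn
    (fun i => (hc i).2.2.2.1) (fun i => (hc i).2.2.2.2.1) (fun i => (hc i).2.2.2.2.2) (N12Dead1_of_n12Dead1L h)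

/-- **`n12DeadL` is sound.** [folklore] -/
theorem not_n12DeadL [DecidableEq H] (hn : Fintype.card H = n) {P : List Shape} (hP : Realizable H P) : n12DeadL n P = false := by
  rw [Bool.eq_false_iff]
  intro h
  simp only [n12DeadL, Bool.or_eq_true] at h
  rcases h with (h | h) | h
  · exact false_of_n12Dead1L hn hP h
  · exact false_of_n12Dead1L hn hP.rot h
  · exact false_of_n12Dead1L hn hP.rot.rot h

/-! ## All leaf filters; the `leaf` fact -/

/-- **A realisable pattern passes every leaf filter.** [folklore] -/
theorem not_treeDeadL [DecidableEq H] (hn : Fintype.card H = n) (hn0 : n ≠ 0) {P : List Shape} (hP : Realizable H P) : treeDeadL n P = false := by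
  simp only [treeDeadL, not_repDead hn hP, not_n16DeadL hn hP, not_n8DeadL hn hP, not_n18DeadL hn hn0 hP, not_n12DeadL hn hP, Bool.or_false]

/-- **The `leaf` fact of `SearchHypH`**: a beating pattern passing `leafOK` is not bad (given that the dead list consists of non-realisable patterns). [folklore] -/
theorem leaf_inst [DecidableEq H] (hn : Fintype.card H = n) (hn0 : n ≠ 0) {dead : List (List Shape)} (hdead : ∀ D ∈ dead, ¬ Realizable H D)
    {st : St} {P : List Shape} (hI : Inv n st P) (h : leafOK n dead st P = true) : ¬ Bad n H P := by
  intro hB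
  rw [leafOK, Bool.or_eq_true, Bool.or_eq_true] at h
  rcases h with (h | h) | h
  · exact not_bad_of_nonminimal hI h hB
  · rw [not_treeDeadL hn hn0 hB.1] at h; exact Bool.false_ne_true h
  · exact not_realizable_of_isDead hdead h hB.1

end Summit.MatrixMultiplication.OmegaCensus.KLister
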